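import Literature.AlgebraicGeometry.Motives.MotivatedCyclesProduct
import Literature.AlgebraicGeometry.Motives.LefschetzDecompositionProofs
import Literature.AlgebraicGeometry.Motives.AbelianVarietyHopf
import HarnessLib

/-!
# André's Lemme 1.3.2: the Lefschetz involution of a product on external products

Y. André, *Pour une théorie inconditionnelle des motifs*, Publ. Math. IHÉS 83 (1996), §1.3,
Lemme 1.3.1 and Lemme 1.3.2 (p. 13), for a Weil cohomology theory `W` with the hard Lefschetz
property (`W.HasHardLefschetz`, André's standing hypothesis §1.1) in which exterior sums of
hyperplane classes are hyperplane classes (`W.HasProdHyperplaneClasses`): let `X₁`, `X₂` be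
smooth projective of dimensions `n₁`, `n₂`, polarised by hyperplane classes `η₁`, `η₂`, let
`⋆₁`, `⋆₂` be their Lefschetz involutions (Kleiman's `⋆`, `W.IsLefschetzStar`) and `⋆` the
Lefschetz involution of `X₁ × X₂` for the **product polarisation**
`η = pr₁* η₁ + pr₂* η₂` (`W.prodPolarisation`). Lemme 1.3.2 (verbatim up to OCR): «Il existe des
nombres rationnels `r` tels que pour tous éléments `x ∈ Hᵖ(X)`, `y ∈ H^q(Y)`, on ait :
`⋆_L x ⊗ ⋆_L y = Σ r { L_X^• ⊗ L_Y^• ∘ ⋆_{L_{X×Y}} ∘ (L_X^• x ⊗ L_Y^• y)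
 − L_X^• ⊗ L_Y^• ∘ ⋆_{X×Y} ∘ L_{X×Y} (L_X^• x ⊗ L_Y^• y) }`.» We prove its qualitative form, which
is what André's Prop. 2.1 consumes (p. 15: «et l'on conclut en appliquant le lemme 1.3.2»):

* `WeilCohomology.star_externalCup_star_mem_span` — **`⋆₁ x ⊠ ⋆₂ y` lies in the `K`-span of the
  classes `(η₁ᵃ ⊠ η₂ᵇ) ∪ ⋆((x ⊠ y) ∪ (η₁ᶜ ⊠ η₂ᵍ))`**, `a, b, c, g ∈ ℕ` — one `⋆` per term,
  sandwiched between cup products with exterior monomials in the two polarisations.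

## The argument (bicomponent elimination)

André's half-page proof («à l'aide de la décomposition de Lefschetz … en appliquant le lemme 1.1»)
asserts the existence of the universal coefficients `r`; we give a direct linear-algebra proof
of the span statement which needs no Clebsch–Gordan coefficient. Write `Lᵢ` for the Lefschetz
operator of `ηᵢ`, `L = L_η`, `D = n₁ + n₂`, and, for `p ∈ P^{i₁}(X₁)`, `q ∈ P^{i₂}(X₂)` primitive
(`m₁ = n₁ - i₁`, `m₂ = n₂ - i₂`), call **block** of `(p, q)` the span `B(p, q)` (in each degree) of
the **monomials** `L₁ˢ p ⊠ L₂ᵗ q` (written out in full in the statements: this file introduces no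
definition).

1. `L (a ⊠ b) = L₁ a ⊠ b + a ⊠ L₂ b` (`lefschetzPow_one_mono`), so `L` and the cup product
   with exterior monomials `η₁ᶜ ⊠ η₂ᵍ` preserve blocks, and `Lʳ (p ⊠ q)` lies in the span of the
   monomials `L₁ˢ p ⊠ L₂ᵗ q`, `s + t = r`. Hence `p ⊠ q` is `η`-primitive (for `r = m₁ + m₂ + 1`
   every such monomial dies) and `L^{m₁+m₂} (p ⊠ q) = c · (L₁^{m₁} p ⊠ L₂^{m₂} q)` with `c ≠ 0`
   by hard Lefschetz on `X₁ × X₂` (`Lemme 1.3.1` in this form: `star_topMono`,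
   `⋆(L₁^{m₁} p ⊠ L₂^{m₂} q) = c' · (p ⊠ q)`, `c' ≠ 0`).
2. **Blocks are sub-Lefschetz modules** (`block_hardLefschetz`): `Lʳ : B(p,q)ⁱ → B(p,q)^{2D-i}`,
   `i + r = D`, is onto — it is injective by hard Lefschetz, and the two spaces have the same
   dimension: the monomials are linearly independent (Künneth, axiom (B): distinct monomials of
   one total degree have distinct bidegrees) and `(s, t) ↦ (m₁ - s, m₂ - t)` matches the index
   sets. A general **sub-Lefschetz induction principle** (`subLefschetz_induction`: an `L`-stable
   graded subspace onto which the hard-Lefschetz isomorphisms restrict is spanned by the `Lʲ x`,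
   `x` primitive IN the subspace — the proof of Kleiman 1968 1.4.1 run inside the subspace) then
   shows that blocks are stable under `⋆` (`star_mem_block`).
3. **Elimination** (`mono_mem_starSpan`): decompose `x = Σₖ L₁ᵏ pₖ`, `y = Σₗ L₂ˡ qₗ`
   (Lefschetz, `pₖ ∈ P^{j-2k}`). For a pair `(k, l)` put `c = n₁ - j + k`, `g = n₂ - j' + l`: then
   `L₁ᶜ` sends the component `k` to the TOP `L₁^{mₖ} pₖ` of its string, kills the components
   `k' < k`, and sends `k' > k` strictly below their tops; so
   `(η₁ᵃ ⊠ η₂ᵇ) ∪ ⋆((x ⊠ y) ∪ (η₁ᶜ ⊠ η₂ᵍ)) = c' · (L₁ᵃ pₖ ⊠ L₂ᵇ qₗ) + (terms in the blocks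
   `B(p_{k'}, q_{l'})`, `(k', l') > (k, l)`)`, and a descending induction over the pairs shows that
   every monomial of every block lies in the span. Finally
   `⋆₁ x ⊠ ⋆₂ y = Σ ± L₁^{n₁-j+k} pₖ ⊠ L₂^{n₂-j'+l} qₗ` is a sum of such monomials.

Everything is a theorem: no definitions, no named facts. Consumed by the discharge of André's
Prop. 2.1 (i) (`WeilCohomology.motivatedClasses_cup_le`, file `Motives/MotivatedCyclesCupLeProofs.lean`).

## References

* Y. André, *Pour une théorie inconditionnelle des motifs*, Publ. Math. IHÉS 83 (1996) 5–49:
  §1.1 (Lefschetz decomposition, `⋆_L`), §1.3 Lemme 1.3.1, Lemme 1.3.2 (p. 13), §2.1 proof of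
  Prop. 2.1 (p. 15). [Andre1996Motifs]
* S. Kleiman, *Algebraic cycles and the Weil conjectures* (1968), §1.2 (B) (Künneth), §1.4
  (1.4.1 Lefschetz decomposition, 1.4.2 `⋆`). [Kleiman1968]
-/

universe u v

open CategoryTheory AlgebraicGeometry MonoidalCategory CartesianMonoidalCategory
open scoped TensorProduct

noncomputable section

namespace Literature.AlgebraicGeometry.Motives

namespace WeilCohomology

variable {k : Type u} [Field k] {K : Type v} [Field K] [CharZero K] (W : WeilCohomology k K)

/-! ## One polarised variety: injectivity below the top, `η¹ = η` -/

section Single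

variable {n : ℕ} {X : SchemeOver k} {η : W.obj X 2}

/-- `η¹ = η` for the powers `W.pow` of a class on a smooth projective `X` (`η¹ = 1 ∪ η`); private
copy of `WeilCohomology.pow_one_eq` (`StandardConjecturesKunnethSl2Proofs`, not imported here).
[folklore] -/
private theorem pow_one_eq_self (hX : IsSmoothProjective n X) (η : W.obj X 2) : W.pow X η 1 = η := by
  change W.cup rfl (W.one X) η = η
  exact W.one_cup hX _ η

/-- `L¹ x = x ∪ η`; private copy of `WeilCohomology.lefschetzPow_one_apply`
(`StandardConjecturesKunnethSl2Proofs`, not imported here). [folklore] -/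
private theorem lefschetzPow_one_eq_cup (hX : IsSmoothProjective n X) (η : W.obj X 2) {i j : ℕ}
    (h : i + 2 * 1 = j) (h' : i + 2 = j) (x : W.obj X i) :
    W.lefschetzPow X η 1 i j h x = W.cup h' x η := by
  rw [PreWeilCohomology.lefschetzPow_apply, W.pow_one_eq_self hX]

/-- Under hard Lefschetz, `Lʳ : Hⁱ(X) → Hⁱ⁺²ʳ(X)` is injective as long as `i + r ≤ n`
(`i + r + s = n`: `Lˢ ∘ Lʳ = Lʳ⁺ˢ` is the hard-Lefschetz bijection). [cite: Kleiman1968, §1.4] -/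
theorem lefschetzPow_injective_of_le (hL : W.HasHardLefschetz) (hX : IsSmoothProjective n X)
    (hη : W.IsHyperplaneClass X η) {i r s j : ℕ} (hrs : i + r + s = n) (h : i + 2 * r = j) :
    Function.Injective (W.lefschetzPow X η r i j h) := by
  have hb := hL hX η hη i (r + s) (i + 2 * (r + s)) (by omega) rfl
  intro x y hxy
  apply hb.1
  rw [← W.lefschetzPow_lefschetzPow hX η (r := r) (s := s) (t := r + s) rfl h (by omega) rfl x,
    ← W.lefschetzPow_lefschetzPow hX η (r := r) (s := s) (t := r + s) rfl h (by omega) rfl y, hxy]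

/-- A nonzero primitive class `p ∈ Pⁱ(X)` has `Lˢ p ≠ 0` for `i + s ≤ n` (`i + s + e = n`).
[cite: Kleiman1968, §1.4] -/
theorem lefschetzPow_ne_zero_of_le (hL : W.HasHardLefschetz) (hX : IsSmoothProjective n X)
    (hη : W.IsHyperplaneClass X η) {i s e j : ℕ} (hse : i + s + e = n) (h : i + 2 * s = j)
    {p : W.obj X i} (hp : p ≠ 0) : W.lefschetzPow X η s i j h p ≠ 0 := fun h0 ↦
  hp (W.lefschetzPow_injective_of_le hL hX hη hse h (by rw [h0, map_zero]))

end Single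

/-! ## Two polarised varieties: monomials and blocks -/

section Product

variable {n₁ n₂ : ℕ} {X₁ X₂ : SchemeOver k} {η₁ : W.obj X₁ 2} {η₂ : W.obj X₂ 2}

variable {i₁ i₂ : ℕ} {a : W.obj X₁ i₁} {b : W.obj X₂ i₂}

/-- Monomials lie in the block. [folklore] -/
theorem mono_mem_block (s t N : ℕ) (h : i₁ + 2 * s + (i₂ + 2 * t) = N) :
    W.externalCup X₁ X₂ h (W.lefschetzPow X₁ η₁ s i₁ (i₁ + 2 * s) rfl a) (W.lefschetzPow X₂ η₂ t i₂ (i₂ + 2 * t) rfl b) ∈ Submodule.span K {z : W.obj (X₁ ⊗ X₂) N | ∃ (s t : ℕ) (h : i₁ + 2 * s + (i₂ + 2 * t) = N), z = W.externalCup X₁ X₂ h (W.lefschetzPow X₁ η₁ s i₁ (i₁ + 2 * s) rfl a) (W.lefschetzPow X₂ η₂ t i₂ (i₂ + 2 * t) rfl b)} :=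
  Submodule.subset_span ⟨s, t, h, rfl⟩

/-- A monomial in external-product form: `L₁ˢ a ⊠ L₂ᵗ b = (a ⊠ b) ∪ (η₁ˢ ⊠ η₂ᵗ)` (graded
commutativity on `X₁ × X₂`; the sign `(-1)^{i₂ · 2s}` is `+1`). [folklore] -/
theorem mono_eq_cup (hX₁ : IsSmoothProjective n₁ X₁) (hX₂ : IsSmoothProjective n₂ X₂)
    (s t N : ℕ) (h : i₁ + 2 * s + (i₂ + 2 * t) = N) (h' : i₁ + i₂ + (2 * s + 2 * t) = N) :
    W.externalCup X₁ X₂ h (W.lefschetzPow X₁ η₁ s i₁ (i₁ + 2 * s) rfl a) (W.lefschetzPow X₂ η₂ t i₂ (i₂ + 2 * t) rfl b) =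
      W.cup h' (W.externalCup X₁ X₂ rfl a b)
        (W.externalCup X₁ X₂ rfl (W.pow X₁ η₁ s) (W.pow X₂ η₂ t)) := by
  rw [W.cup_externalCup_externalCup hX₁ hX₂ rfl rfl h' rfl rfl h,
    negOnePow_mul_eq_one (Or.inr ⟨s, by ring⟩), Units.val_one, one_smul]
  rfl

/-- The monomial with no Lefschetz operators is `a ⊠ b`. [folklore] -/
theorem mono_zero_zero (hX₁ : IsSmoothProjective n₁ X₁) (hX₂ : IsSmoothProjective n₂ X₂)
    {N : ℕ} (h : i₁ + 2 * 0 + (i₂ + 2 * 0) = N) (h' : i₁ + i₂ = N) :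
    W.externalCup X₁ X₂ h (W.lefschetzPow X₁ η₁ 0 i₁ (i₁ + 2 * 0) rfl a) (W.lefschetzPow X₂ η₂ 0 i₂ (i₂ + 2 * 0) rfl b) = W.externalCup X₁ X₂ h' a b := by
  subst h'
  show W.externalCup X₁ X₂ rfl (W.lefschetzPow X₁ η₁ 0 i₁ i₁ rfl a)
      (W.lefschetzPow X₂ η₂ 0 i₂ i₂ rfl b) = _
  rw [W.lefschetzPow_zero_apply hX₁, W.lefschetzPow_zero_apply hX₂]

/-- Cup product with an exterior monomial shifts a monomial:
`(L₁ˢ a ⊠ L₂ᵗ b) ∪ (η₁ᶜ ⊠ η₂ᵍ) = L₁ˢ⁺ᶜ a ⊠ L₂ᵗ⁺ᵍ b`. [folklore] -/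
theorem mono_cup_extPow (hX₁ : IsSmoothProjective n₁ X₁) (hX₂ : IsSmoothProjective n₂ X₂)
    (s t N : ℕ) (h : i₁ + 2 * s + (i₂ + 2 * t) = N) (c g M : ℕ) (hM : N + (2 * c + 2 * g) = M)
    (h' : i₁ + 2 * (s + c) + (i₂ + 2 * (t + g)) = M) :
    W.cup hM (W.externalCup X₁ X₂ h (W.lefschetzPow X₁ η₁ s i₁ (i₁ + 2 * s) rfl a) (W.lefschetzPow X₂ η₂ t i₂ (i₂ + 2 * t) rfl b))
        (W.externalCup X₁ X₂ rfl (W.pow X₁ η₁ c) (W.pow X₂ η₂ g)) =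
      W.externalCup X₁ X₂ h' (W.lefschetzPow X₁ η₁ (s + c) i₁ (i₁ + 2 * (s + c)) rfl a) (W.lefschetzPow X₂ η₂ (t + g) i₂ (i₂ + 2 * (t + g)) rfl b) := by
  rw [W.cup_externalCup_externalCup hX₁ hX₂ h rfl hM
      (show i₁ + 2 * s + 2 * c = i₁ + 2 * (s + c) by omega)
      (show i₂ + 2 * t + 2 * g = i₂ + 2 * (t + g) by omega) h',
    negOnePow_mul_eq_one (Or.inr ⟨c, by ring⟩), Units.val_one, one_smul,
    ← PreWeilCohomology.lefschetzPow_apply, ← PreWeilCohomology.lefschetzPow_apply,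
    W.lefschetzPow_lefschetzPow hX₁ η₁ (rfl : s + c = s + c) rfl _ rfl a,
    W.lefschetzPow_lefschetzPow hX₂ η₂ (rfl : t + g = t + g) rfl _ rfl b]

/-- Cup product with an exterior monomial `η₁ᶜ ⊠ η₂ᵍ` maps blocks to blocks. [folklore] -/
theorem cup_extPow_mem_block (hX₁ : IsSmoothProjective n₁ X₁) (hX₂ : IsSmoothProjective n₂ X₂)
    {N : ℕ} {z : W.obj (X₁ ⊗ X₂) N} (hz : z ∈ Submodule.span K {z : W.obj (X₁ ⊗ X₂) N | ∃ (s t : ℕ) (h : i₁ + 2 * s + (i₂ + 2 * t) = N), z = W.externalCup X₁ X₂ h (W.lefschetzPow X₁ η₁ s i₁ (i₁ + 2 * s) rfl a) (W.lefschetzPow X₂ η₂ t i₂ (i₂ + 2 * t) rfl b)}) (c g M : ℕ)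
    (hM : N + (2 * c + 2 * g) = M) :
    W.cup hM z (W.externalCup X₁ X₂ rfl (W.pow X₁ η₁ c) (W.pow X₂ η₂ g)) ∈
      Submodule.span K {z : W.obj (X₁ ⊗ X₂) M | ∃ (s t : ℕ) (h : i₁ + 2 * s + (i₂ + 2 * t) = M), z = W.externalCup X₁ X₂ h (W.lefschetzPow X₁ η₁ s i₁ (i₁ + 2 * s) rfl a) (W.lefschetzPow X₂ η₂ t i₂ (i₂ + 2 * t) rfl b)} := by
  induction hz using Submodule.span_induction with
  | mem z hz =>
    obtain ⟨s, t, h, rfl⟩ := hz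
    rw [W.mono_cup_extPow hX₁ hX₂ s t N h c g M hM (by omega)]
    exact W.mono_mem_block _ _ _ _
  | zero => rw [LinearMap.map_zero₂]; exact zero_mem _
  | add z z' _ _ hz hz' => rw [LinearMap.map_add₂]; exact add_mem hz hz'
  | smul c z _ hz => rw [LinearMap.map_smul₂]; exact Submodule.smul_mem _ c hz

/-- **The Lefschetz operator of the product polarisation on a monomial**:
`L (L₁ˢ a ⊠ L₂ᵗ b) = L₁ˢ⁺¹ a ⊠ L₂ᵗ b + L₁ˢ a ⊠ L₂ᵗ⁺¹ b` (André 1996 §1.3: the Künneth isomorphism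
is `𝔰𝔩₂`-equivariant for `η = pr₁* η₁ + pr₂* η₂`, i.e. `L = L₁ ⊗ 1 + 1 ⊗ L₂`). [cite: Andre1996Motifs, §1.3] -/
theorem lefschetzPow_one_mono (hX₁ : IsSmoothProjective n₁ X₁)
    (hX₂ : IsSmoothProjective n₂ X₂) (s t N : ℕ) (h : i₁ + 2 * s + (i₂ + 2 * t) = N) (M : ℕ)
    (hM : N + 2 * 1 = M) (h₁ : i₁ + 2 * (s + 1) + (i₂ + 2 * t) = M)
    (h₂ : i₁ + 2 * s + (i₂ + 2 * (t + 1)) = M) :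
    W.lefschetzPow (X₁ ⊗ X₂) (W.prodPolarisation X₁ X₂ η₁ η₂) 1 N M hM
        (W.externalCup X₁ X₂ h (W.lefschetzPow X₁ η₁ s i₁ (i₁ + 2 * s) rfl a) (W.lefschetzPow X₂ η₂ t i₂ (i₂ + 2 * t) rfl b)) =
      W.externalCup X₁ X₂ h₁ (W.lefschetzPow X₁ η₁ (s + 1) i₁ (i₁ + 2 * (s + 1)) rfl a) (W.lefschetzPow X₂ η₂ t i₂ (i₂ + 2 * t) rfl b) + W.externalCup X₁ X₂ h₂ (W.lefschetzPow X₁ η₁ s i₁ (i₁ + 2 * s) rfl a) (W.lefschetzPow X₂ η₂ (t + 1) i₂ (i₂ + 2 * (t + 1)) rfl b) := by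
  have hP := IsSmoothProjective.tensor_holds hX₁ hX₂
  have hfst : W.pullback (fst X₁ X₂) 2 η₁ =
      W.externalCup X₁ X₂ rfl (W.pow X₁ η₁ 1) (W.pow X₂ η₂ 0) := by
    rw [W.pullback_fst_eq_externalCup hX₁ hX₂ η₁, W.pow_one_eq_self hX₁]
    rfl
  have hsnd : W.pullback (snd X₁ X₂) 2 η₂ =
      W.externalCup X₁ X₂ rfl (W.pow X₁ η₁ 0) (W.pow X₂ η₂ 1) := by
    rw [W.pullback_snd_eq_externalCup hX₁ hX₂ η₂, W.pow_one_eq_self hX₂]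
    rfl
  rw [W.lefschetzPow_one_eq_cup hP _ hM (by omega), PreWeilCohomology.prodPolarisation_def, map_add,
    hfst, hsnd]
  show W.cup (show N + (2 * 1 + 2 * 0) = M by omega) (W.externalCup X₁ X₂ h (W.lefschetzPow X₁ η₁ s i₁ (i₁ + 2 * s) rfl a) (W.lefschetzPow X₂ η₂ t i₂ (i₂ + 2 * t) rfl b))
        (W.externalCup X₁ X₂ rfl (W.pow X₁ η₁ 1) (W.pow X₂ η₂ 0)) +
      W.cup (show N + (2 * 0 + 2 * 1) = M by omega) (W.externalCup X₁ X₂ h (W.lefschetzPow X₁ η₁ s i₁ (i₁ + 2 * s) rfl a) (W.lefschetzPow X₂ η₂ t i₂ (i₂ + 2 * t) rfl b))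
        (W.externalCup X₁ X₂ rfl (W.pow X₁ η₁ 0) (W.pow X₂ η₂ 1)) = _
  rw [W.mono_cup_extPow hX₁ hX₂ s t N h 1 0 M _ (by omega),
    W.mono_cup_extPow hX₁ hX₂ s t N h 0 1 M _ (by omega)]
  rfl

/-- The Lefschetz operator `L` of the product polarisation maps blocks to blocks. [folklore] -/
theorem lefschetzPow_one_mem_block (hX₁ : IsSmoothProjective n₁ X₁)
    (hX₂ : IsSmoothProjective n₂ X₂) {N M : ℕ} (hM : N + 2 * 1 = M) {z : W.obj (X₁ ⊗ X₂) N}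
    (hz : z ∈ Submodule.span K {z : W.obj (X₁ ⊗ X₂) N | ∃ (s t : ℕ) (h : i₁ + 2 * s + (i₂ + 2 * t) = N), z = W.externalCup X₁ X₂ h (W.lefschetzPow X₁ η₁ s i₁ (i₁ + 2 * s) rfl a) (W.lefschetzPow X₂ η₂ t i₂ (i₂ + 2 * t) rfl b)}) :
    W.lefschetzPow (X₁ ⊗ X₂) (W.prodPolarisation X₁ X₂ η₁ η₂) 1 N M hM z ∈
      Submodule.span K {z : W.obj (X₁ ⊗ X₂) M | ∃ (s t : ℕ) (h : i₁ + 2 * s + (i₂ + 2 * t) = M), z = W.externalCup X₁ X₂ h (W.lefschetzPow X₁ η₁ s i₁ (i₁ + 2 * s) rfl a) (W.lefschetzPow X₂ η₂ t i₂ (i₂ + 2 * t) rfl b)} := by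
  induction hz using Submodule.span_induction with
  | mem z hz =>
    obtain ⟨s, t, h, rfl⟩ := hz
    rw [W.lefschetzPow_one_mono hX₁ hX₂ s t N h M hM (by omega) (by omega)]
    exact add_mem (W.mono_mem_block _ _ _ _) (W.mono_mem_block _ _ _ _)
  | zero => rw [map_zero]; exact zero_mem _
  | add z z' _ _ hz hz' => rw [map_add]; exact add_mem hz hz'
  | smul c z _ hz => rw [map_smul]; exact Submodule.smul_mem _ c hz

/-- The iterated Lefschetz operators `Lʳ` of the product polarisation map blocks to blocks.
[folklore] -/
theorem lefschetzPow_mem_block (hX₁ : IsSmoothProjective n₁ X₁)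
    (hX₂ : IsSmoothProjective n₂ X₂) :
    ∀ (r : ℕ) {N M : ℕ} (hM : N + 2 * r = M) {z : W.obj (X₁ ⊗ X₂) N},
      z ∈ Submodule.span K {z : W.obj (X₁ ⊗ X₂) N | ∃ (s t : ℕ) (h : i₁ + 2 * s + (i₂ + 2 * t) = N), z = W.externalCup X₁ X₂ h (W.lefschetzPow X₁ η₁ s i₁ (i₁ + 2 * s) rfl a) (W.lefschetzPow X₂ η₂ t i₂ (i₂ + 2 * t) rfl b)} →
        W.lefschetzPow (X₁ ⊗ X₂) (W.prodPolarisation X₁ X₂ η₁ η₂) r N M hM z ∈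
          Submodule.span K {z : W.obj (X₁ ⊗ X₂) M | ∃ (s t : ℕ) (h : i₁ + 2 * s + (i₂ + 2 * t) = M), z = W.externalCup X₁ X₂ h (W.lefschetzPow X₁ η₁ s i₁ (i₁ + 2 * s) rfl a) (W.lefschetzPow X₂ η₂ t i₂ (i₂ + 2 * t) rfl b)}
  | 0, N, M, hM, z, hz => by
    obtain rfl : N = M := by omega
    rwa [W.lefschetzPow_zero_apply (IsSmoothProjective.tensor_holds hX₁ hX₂)]
  | r + 1, N, M, hM, z, hz => by
    have hP := IsSmoothProjective.tensor_holds hX₁ hX₂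
    rw [← W.lefschetzPow_lefschetzPow hP _ (r := r) (s := 1) (t := r + 1) rfl
      (rfl : N + 2 * r = N + 2 * r) (by omega) hM z]
    exact W.lefschetzPow_one_mem_block hX₁ hX₂ _ (lefschetzPow_mem_block hX₁ hX₂ r rfl hz)

/-- `Lʳ (a ⊠ b)` lies in the span of the monomials `L₁ˢ a ⊠ L₂ᵗ b` with `s + t = r` (the
qualitative binomial expansion of `(L₁ ⊗ 1 + 1 ⊗ L₂)ʳ`). [cite: Andre1996Motifs, §1.3] -/
theorem lefschetzPow_externalCup_mem_span (hX₁ : IsSmoothProjective n₁ X₁)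
    (hX₂ : IsSmoothProjective n₂ X₂) :
    ∀ (r : ℕ) {M : ℕ} (hM : i₁ + i₂ + 2 * r = M),
      W.lefschetzPow (X₁ ⊗ X₂) (W.prodPolarisation X₁ X₂ η₁ η₂) r (i₁ + i₂) M hM
          (W.externalCup X₁ X₂ rfl a b) ∈
        Submodule.span K {z | ∃ (s t : ℕ) (_ : s + t = r)
          (h : i₁ + 2 * s + (i₂ + 2 * t) = M), z = W.externalCup X₁ X₂ h (W.lefschetzPow X₁ η₁ s i₁ (i₁ + 2 * s) rfl a) (W.lefschetzPow X₂ η₂ t i₂ (i₂ + 2 * t) rfl b)}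
  | 0, M, hM => by
    obtain rfl : i₁ + i₂ = M := by omega
    rw [W.lefschetzPow_zero_apply (IsSmoothProjective.tensor_holds hX₁ hX₂)]
    refine Submodule.subset_span ⟨0, 0, rfl, rfl, ?_⟩
    rw [W.mono_zero_zero hX₁ hX₂ rfl rfl]
  | r + 1, M, hM => by
    have hP := IsSmoothProjective.tensor_holds hX₁ hX₂
    rw [← W.lefschetzPow_lefschetzPow hP _ (r := r) (s := 1) (t := r + 1) rfl
      (rfl : i₁ + i₂ + 2 * r = _) (by omega) hM]
    have ih := lefschetzPow_externalCup_mem_span hX₁ hX₂ r (M := i₁ + i₂ + 2 * r) rfl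
    -- push `L` through the span
    refine Submodule.span_induction (p := fun z _ ↦
        W.lefschetzPow (X₁ ⊗ X₂) (W.prodPolarisation X₁ X₂ η₁ η₂) 1 (i₁ + i₂ + 2 * r) M
          (by omega) z ∈ Submodule.span K {z | ∃ (s t : ℕ) (_ : s + t = r + 1)
            (h : i₁ + 2 * s + (i₂ + 2 * t) = M), z = W.externalCup X₁ X₂ h (W.lefschetzPow X₁ η₁ s i₁ (i₁ + 2 * s) rfl a) (W.lefschetzPow X₂ η₂ t i₂ (i₂ + 2 * t) rfl b)})
      ?_ ?_ ?_ ?_ ih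
    · rintro z ⟨s, t, hst, h, rfl⟩
      rw [W.lefschetzPow_one_mono hX₁ hX₂ s t _ h M (by omega) (by omega) (by omega)]
      exact add_mem (Submodule.subset_span ⟨s + 1, t, by omega, by omega, rfl⟩)
        (Submodule.subset_span ⟨s, t + 1, by omega, by omega, rfl⟩)
    · rw [map_zero]; exact zero_mem _
    · intro z z' _ _ hz hz'; rw [map_add]; exact add_mem hz hz'
    · intro c z _ hz; rw [map_smul]; exact Submodule.smul_mem _ c hz

end Product

/-! ## Sub-Lefschetz modules: the Lefschetz decomposition inside an `L`-stable subspace -/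

section SubLefschetz

variable {D : ℕ} {P : SchemeOver k} {η : W.obj P 2} (U : (a : ℕ) → Submodule K (W.obj P a))

/-- In an `L`-stable graded subspace `U ⊆ H•(P)`, all iterates `Lʳ` stay in `U`. [folklore] -/
theorem lefschetzPow_mem_of_forall_mem (hP : IsSmoothProjective D P)
    (hUL : ∀ {a b : ℕ} (h : a + 2 * 1 = b) {x : W.obj P a},
      x ∈ U a → W.lefschetzPow P η 1 a b h x ∈ U b) :
    ∀ (r : ℕ) {a b : ℕ} (h : a + 2 * r = b) {x : W.obj P a},
      x ∈ U a → W.lefschetzPow P η r a b h x ∈ U b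
  | 0, a, b, h, x, hx => by
    obtain rfl : a = b := by omega
    rwa [W.lefschetzPow_zero_apply hP]
  | r + 1, a, b, h, x, hx => by
    rw [← W.lefschetzPow_lefschetzPow hP η (r := r) (s := 1) (t := r + 1) rfl
      (rfl : a + 2 * r = a + 2 * r) (by omega) h x]
    exact hUL _ (lefschetzPow_mem_of_forall_mem hP hUL r rfl hx)

/-- In an `L`-stable graded subspace `U` onto which the hard-Lefschetz isomorphisms restrict,
the operator `lowerOp : Hᵐ⁺²(P) → Hᵐ(P)` (`y ↦ (Lʳ⁺²)⁻¹ (Lʳ⁺¹ y)`, the `L Hᵐ`-component followed by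
`L⁻¹`, Kleiman 1968 §1.4 proof of 1.4.1) maps `U` into `U`. [cite: Kleiman1968, §1.4 (1.4.1)] -/
theorem lowerOp_mem_of_forall_mem (hL : W.HasHardLefschetz) (hP : IsSmoothProjective D P)
    (hη : W.IsHyperplaneClass P η)
    (hUL : ∀ {a b : ℕ} (h : a + 2 * 1 = b) {x : W.obj P a},
      x ∈ U a → W.lefschetzPow P η 1 a b h x ∈ U b)
    (hUHL : ∀ {i r j : ℕ}, i + r = D → ∀ (h : i + 2 * r = j), ∀ z ∈ U j,
      ∃ w ∈ U i, W.lefschetzPow P η r i j h w = z)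
    {m r : ℕ} (hr : m + 2 + r = D) {y : W.obj P (m + 2)} (hy : y ∈ U (m + 2)) :
    W.lowerOp hL hP hη m r hr y ∈ U m := by
  have h1 : W.lefschetzPow P η (r + 1) (m + 2) (m + 2 * (r + 2)) (by omega) y ∈
      U (m + 2 * (r + 2)) :=
    W.lefschetzPow_mem_of_forall_mem U hP hUL (r + 1) _ hy
  obtain ⟨w, hw, hLw⟩ := hUHL (i := m) (r := r + 2) (by omega) rfl _ h1
  simp only [lowerOp, LinearMap.coe_comp, LinearEquiv.coe_coe, Function.comp_apply]
  rw [← hLw, hardLefschetzEquiv_symm_apply_lefschetzPow]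
  exact hw

/-- **Sub-Lefschetz spanning principle, degrees `a ≤ D`**: in an `L`-stable graded subspace
`U ⊆ H•(P)` onto which the hard-Lefschetz isomorphisms restrict, an additive property of classes
of `Hᵃ(P)` holding on all `Lʲ x` with `x ∈ U ∩ Pⁱ(P)` primitive (`i + 2j = a`) holds on `U ∩ Hᵃ(P)`:
the proof of the Lefschetz decomposition (Kleiman 1968 1.4.1, two-step induction through
`Hᵐ⁺² = Pᵐ⁺² ⊕ L Hᵐ`) run inside `U`, the point being that `lowerOp` preserves `U`
(`lowerOp_mem_of_forall_mem`). [cite: Kleiman1968, §1.4 (1.4.1)] -/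
theorem subLefschetz_induction_of_le (hL : W.HasHardLefschetz) (hP : IsSmoothProjective D P)
    (hη : W.IsHyperplaneClass P η)
    (hUL : ∀ {a b : ℕ} (h : a + 2 * 1 = b) {x : W.obj P a},
      x ∈ U a → W.lefschetzPow P η 1 a b h x ∈ U b)
    (hUHL : ∀ {i r j : ℕ}, i + r = D → ∀ (h : i + 2 * r = j), ∀ z ∈ U j,
      ∃ w ∈ U i, W.lefschetzPow P η r i j h w = z) :
    ∀ (a : ℕ), a ≤ D → ∀ {C : W.obj P a → Prop}, C 0 → (∀ y z, C y → C z → C (y + z)) →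
      (∀ (i j : ℕ) (h : i + 2 * j = a) (x : W.obj P i), x ∈ U i → W.IsPrimitive D η x →
        C (W.lefschetzPow P η j i a h x)) → ∀ y ∈ U a, C y := by
  intro a
  induction a using Nat.twoStepInduction with
  | zero =>
    intro _ C _ _ prim y hy
    have hy' : W.IsPrimitive D η y :=
      ⟨fun h ↦ absurd h (Nat.not_lt_zero D), fun r j h hr ↦ by
        haveI := W.subsingleton_obj hP (i := j) (by omega)
        exact Subsingleton.elim _ _⟩
    simpa only [W.lefschetzPow_zero_apply hP] using prim 0 0 (by omega) y hy hy'
  | one =>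
    intro hn C _ _ prim y hy
    have hy' : W.IsPrimitive D η y :=
      ⟨fun h ↦ absurd h (by omega), fun r j h hr ↦ by
        haveI := W.subsingleton_obj hP (i := j) (by omega)
        exact Subsingleton.elim _ _⟩
    simpa only [W.lefschetzPow_zero_apply hP] using prim 1 0 (by omega) y hy hy'
  | more m ih _ =>
    intro hm C zero add prim y hy
    obtain ⟨r, hr⟩ : ∃ r, m + 2 + r = D := ⟨D - (m + 2), by omega⟩
    have h2m : m + 2 * 1 = m + 2 := by omega
    have hlow : W.lowerOp hL hP hη m r hr y ∈ U m :=
      W.lowerOp_mem_of_forall_mem U hL hP hη hUL hUHL hr hy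
    have h₁ : C (y - W.lefschetzPow P η 1 m (m + 2) h2m (W.lowerOp hL hP hη m r hr y)) := by
      have hmem : y - W.lefschetzPow P η 1 m (m + 2) h2m (W.lowerOp hL hP hη m r hr y) ∈
          U (m + 2) := sub_mem hy (hUL h2m hlow)
      simpa only [W.lefschetzPow_zero_apply hP] using
        prim (m + 2) 0 (by omega) _ hmem (W.isPrimitive_sub_lowerOp hL hP hη hr h2m y)
    have h₂ : C (W.lefschetzPow P η 1 m (m + 2) h2m (W.lowerOp hL hP hη m r hr y)) := by
      refine ih (by omega) (C := fun z ↦ C (W.lefschetzPow P η 1 m (m + 2) h2m z)) ?_ ?_ ?_ _ hlow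
      · simpa only [map_zero] using zero
      · intro y' z' hy' hz'
        simpa only [map_add] using add _ _ hy' hz'
      · intro i j h x hxU hx
        have h3 : i + 2 * (j + 1) = m + 2 := by omega
        simpa only [W.lefschetzPow_lefschetzPow hP η (r := j) (s := 1) (t := j + 1) rfl h h2m h3]
          using prim i (j + 1) h3 x hxU hx
    simpa only [sub_add_cancel] using add _ _ h₁ h₂

/-- **Sub-Lefschetz spanning principle** (all degrees): in an `L`-stable graded subspace
`U ⊆ H•(P)` onto which the hard-Lefschetz isomorphisms restrict, an additive property of classes
of `Hᵃ(P)` holding on all `Lʲ x` with `x ∈ U ∩ Pⁱ(P)` primitive, `i + 2j = a`, `i + j ≤ D`, holds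
on `U ∩ Hᵃ(P)` (for `D < a ≤ 2D` transport from `U ∩ H^{2D-a}` along `Lᵃ⁻ᴰ`, which maps it ONTO
`U ∩ Hᵃ`; `Hᵃ = 0` above `2D`). [cite: Kleiman1968, §1.4 (1.4.1)] -/
theorem subLefschetz_induction (hL : W.HasHardLefschetz) (hP : IsSmoothProjective D P)
    (hη : W.IsHyperplaneClass P η)
    (hUL : ∀ {a b : ℕ} (h : a + 2 * 1 = b) {x : W.obj P a},
      x ∈ U a → W.lefschetzPow P η 1 a b h x ∈ U b)
    (hUHL : ∀ {i r j : ℕ}, i + r = D → ∀ (h : i + 2 * r = j), ∀ z ∈ U j,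
      ∃ w ∈ U i, W.lefschetzPow P η r i j h w = z)
    {a : ℕ} {C : W.obj P a → Prop} (zero : C 0) (add : ∀ y z, C y → C z → C (y + z))
    (prim : ∀ (i j : ℕ) (h : i + 2 * j = a) (x : W.obj P i), x ∈ U i → W.IsPrimitive D η x →
      i + j ≤ D → C (W.lefschetzPow P η j i a h x))
    {y : W.obj P a} (hy : y ∈ U a) : C y := by
  by_cases ha : a ≤ D
  · exact W.subLefschetz_induction_of_le U hL hP hη hUL hUHL a ha zero add
      (fun i j h x hxU hx ↦ prim i j h x hxU hx (by omega)) y hy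
  by_cases h2 : a ≤ 2 * D
  · obtain ⟨b, r, hbr, hba⟩ : ∃ b r, b + r = D ∧ b + 2 * r = a :=
      ⟨2 * D - a, a - D, by omega, by omega⟩
    obtain ⟨w, hw, rfl⟩ := hUHL hbr hba y hy
    refine W.subLefschetz_induction_of_le U hL hP hη hUL hUHL b (by omega)
      (C := fun z ↦ C (W.lefschetzPow P η r b a hba z)) ?_ ?_ ?_ w hw
    · simpa only [map_zero] using zero
    · intro y' z' hy' hz'
      simpa only [map_add] using add _ _ hy' hz'
    · intro i j h x hxU hx
      have h3 : i + 2 * (j + r) = a := by omega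
      simpa only [W.lefschetzPow_lefschetzPow hP η rfl h hba h3 x] using
        prim i (j + r) h3 x hxU hx (by omega)
  · haveI := W.subsingleton_obj hP (i := a) (by omega)
    rw [Subsingleton.elim y 0]
    exact zero

/-- **`⋆` preserves sub-Lefschetz modules**: if `S` is a Lefschetz star operator of `(P, η)`
(`W.IsLefschetzStar`), an `L`-stable graded subspace `U` onto which the hard-Lefschetz
isomorphisms restrict is stable under `S` (on `Lʲ x`, `x ∈ U` primitive, `S` is `± Lˢ x ∈ U`).
[cite: Kleiman1968, 1.4.2] -/
theorem star_mem_of_forall_mem (hL : W.HasHardLefschetz) (hP : IsSmoothProjective D P)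
    (hη : W.IsHyperplaneClass P η)
    (hUL : ∀ {a b : ℕ} (h : a + 2 * 1 = b) {x : W.obj P a},
      x ∈ U a → W.lefschetzPow P η 1 a b h x ∈ U b)
    (hUHL : ∀ {i r j : ℕ}, i + r = D → ∀ (h : i + 2 * r = j), ∀ z ∈ U j,
      ∃ w ∈ U i, W.lefschetzPow P η r i j h w = z)
    {S : W.GradedOp P P} (hS : W.IsLefschetzStar D η S) {a b : ℕ} {y : W.obj P a}
    (hy : y ∈ U a) : S a b y ∈ U b := by
  by_cases hab : a + b = 2 * D
  · refine W.subLefschetz_induction U hL hP hη hUL hUHL (C := fun y ↦ S a b y ∈ U b)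
      (by simp only [map_zero]; exact zero_mem _) (fun y z hy hz ↦ by
        simp only [map_add]; exact add_mem hy hz) ?_ hy
    intro i j h x hxU hx hij
    obtain ⟨s, hs⟩ : ∃ s, i + j + s = D := ⟨D - (i + j), by omega⟩
    have hb : i + 2 * s = b := by omega
    rw [hS.2 i x hx j s a b h hb hs, ← Int.cast_smul_eq_zsmul K]
    exact Submodule.smul_mem _ _ (W.lefschetzPow_mem_of_forall_mem U hP hUL s hb hxU)
  · rw [hS.1 a b hab, LinearMap.zero_apply]
    exact zero_mem _

end SubLefschetz

/-! ## Blocks of bi-primitive classes are sub-Lefschetz modules -/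

section BlockStructure

variable {n₁ n₂ : ℕ} {X₁ X₂ : SchemeOver k} {η₁ : W.obj X₁ 2} {η₂ : W.obj X₂ 2}
variable {i₁ i₂ : ℕ} {p : W.obj X₁ i₁} {q : W.obj X₂ i₂}

omit [CharZero K] in
/-- Over a field, the elementary tensor of two nonzero vectors is nonzero (test against a pair of
linear forms not vanishing on them). [folklore] -/
private theorem tmul_ne_zero' {V₁ V₂ : Type*} [AddCommGroup V₁] [Module K V₁] [AddCommGroup V₂]
    [Module K V₂] {v : V₁} {w : V₂} (hv : v ≠ 0) (hw : w ≠ 0) : v ⊗ₜ[K] w ≠ 0 := by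
  obtain ⟨φ, hφ⟩ := Module.Projective.exists_dual_ne_zero K hv
  obtain ⟨ψ, hψ⟩ := Module.Projective.exists_dual_ne_zero K hw
  intro h
  have h' : TensorProduct.lift ((LinearMap.mul K K).compl₁₂ φ ψ) (v ⊗ₜ[K] w) = φ v * ψ w := by
    rw [TensorProduct.lift.tmul]
    rfl
  rw [h, map_zero] at h'
  exact mul_ne_zero hφ hψ h'.symm

/-- A monomial `L₁ˢ p ⊠ L₂ᵗ q` with `p` primitive and `i₁ + s > n₁` vanishes. [folklore] -/
theorem mono_eq_zero_left (hX₁ : IsSmoothProjective n₁ X₁) (hp : W.IsPrimitive n₁ η₁ p)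
    {s t N : ℕ} (h : i₁ + 2 * s + (i₂ + 2 * t) = N) (hs : n₁ + 1 ≤ i₁ + s) :
    W.externalCup X₁ X₂ h (W.lefschetzPow X₁ η₁ s i₁ (i₁ + 2 * s) rfl p) (W.lefschetzPow X₂ η₂ t i₂ (i₂ + 2 * t) rfl q) = 0 := by
  rw [W.lefschetzPow_eq_zero_of_isPrimitive hX₁ η₁ hp rfl hs, LinearMap.map_zero₂]

/-- A monomial `L₁ˢ p ⊠ L₂ᵗ q` with `q` primitive and `i₂ + t > n₂` vanishes. [folklore] -/
theorem mono_eq_zero_right (hX₂ : IsSmoothProjective n₂ X₂) (hq : W.IsPrimitive n₂ η₂ q)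
    {s t N : ℕ} (h : i₁ + 2 * s + (i₂ + 2 * t) = N) (ht : n₂ + 1 ≤ i₂ + t) :
    W.externalCup X₁ X₂ h (W.lefschetzPow X₁ η₁ s i₁ (i₁ + 2 * s) rfl p) (W.lefschetzPow X₂ η₂ t i₂ (i₂ + 2 * t) rfl q) = 0 := by
  rw [W.lefschetzPow_eq_zero_of_isPrimitive hX₂ η₂ hq rfl ht, map_zero]

/-- For `p`, `q` primitive (`i₁ + m₁ = n₁`, `i₂ + m₂ = n₂`), the block of degree `M` is spanned by
the monomials `L₁ˢ p ⊠ L₂ᵗ q` with `s ≤ m₁`, `t ≤ m₂` (the others vanish). [folklore] -/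
theorem block_eq_span_range (hX₁ : IsSmoothProjective n₁ X₁) (hX₂ : IsSmoothProjective n₂ X₂)
    (hp : W.IsPrimitive n₁ η₁ p) (hq : W.IsPrimitive n₂ η₂ q) {m₁ m₂ : ℕ} (hm₁ : i₁ + m₁ = n₁)
    (hm₂ : i₂ + m₂ = n₂) (M : ℕ) :
    Submodule.span K {z : W.obj (X₁ ⊗ X₂) M | ∃ (s t : ℕ) (h : i₁ + 2 * s + (i₂ + 2 * t) = M), z = W.externalCup X₁ X₂ h (W.lefschetzPow X₁ η₁ s i₁ (i₁ + 2 * s) rfl p) (W.lefschetzPow X₂ η₂ t i₂ (i₂ + 2 * t) rfl q)} =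
      Submodule.span K (Set.range fun st : {st : Fin (m₁ + 1) × Fin (m₂ + 1) //
          i₁ + 2 * (st.1 : ℕ) + (i₂ + 2 * (st.2 : ℕ)) = M} ↦
        W.externalCup X₁ X₂ st.2 (W.lefschetzPow X₁ η₁ (st.1.1 : ℕ) i₁ (i₁ + 2 * (st.1.1 : ℕ)) rfl p) (W.lefschetzPow X₂ η₂ (st.1.2 : ℕ) i₂ (i₂ + 2 * (st.1.2 : ℕ)) rfl q)) := by
  refine le_antisymm (Submodule.span_le.2 ?_) (Submodule.span_mono ?_)
  · rintro z ⟨s, t, h, rfl⟩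
    by_cases hs : n₁ + 1 ≤ i₁ + s
    · rw [W.mono_eq_zero_left hX₁ hp h hs]
      exact zero_mem _
    by_cases ht : n₂ + 1 ≤ i₂ + t
    · rw [W.mono_eq_zero_right hX₂ hq h ht]
      exact zero_mem _
    exact Submodule.subset_span ⟨⟨(⟨s, by omega⟩, ⟨t, by omega⟩), h⟩, rfl⟩
  · rintro _ ⟨st, rfl⟩
    exact ⟨_, _, st.2, rfl⟩

/-- **The monomials of a block are linearly independent** (Künneth, axiom (B)): for `p`, `q`
primitive and nonzero the classes `L₁ˢ p ⊠ L₂ᵗ q`, `s ≤ m₁`, `t ≤ m₂`, of one total degree are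
linearly independent, having pairwise distinct bidegrees and nonzero Künneth components
`L₁ˢ p ⊗ L₂ᵗ q` (`Lˢ` is injective below the top by hard Lefschetz). [cite: Kleiman1968, §1.2 (B) and §1.4] -/
theorem linearIndependent_mono (hL : W.HasHardLefschetz) (hX₁ : IsSmoothProjective n₁ X₁)
    (hX₂ : IsSmoothProjective n₂ X₂) (hη₁ : W.IsHyperplaneClass X₁ η₁)
    (hη₂ : W.IsHyperplaneClass X₂ η₂) {m₁ m₂ : ℕ} (hm₁ : i₁ + m₁ = n₁) (hm₂ : i₂ + m₂ = n₂)
    (hp0 : p ≠ 0) (hq0 : q ≠ 0) (M : ℕ) :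
    LinearIndependent K (fun st : {st : Fin (m₁ + 1) × Fin (m₂ + 1) //
          i₁ + 2 * (st.1 : ℕ) + (i₂ + 2 * (st.2 : ℕ)) = M} ↦
        W.externalCup X₁ X₂ st.2 (W.lefschetzPow X₁ η₁ (st.1.1 : ℕ) i₁ (i₁ + 2 * (st.1.1 : ℕ)) rfl p) (W.lefschetzPow X₂ η₂ (st.1.2 : ℕ) i₂ (i₂ + 2 * (st.1.2 : ℕ)) rfl q)) := by
  rw [linearIndependent_iff']
  intro S g hg x₀ hx₀
  have key := congrArg
    (W.kunnethComponent hX₁ hX₂ (i₁ + 2 * (x₀.1.1 : ℕ)) (i₂ + 2 * (x₀.1.2 : ℕ)) x₀.2) hg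
  rw [map_sum, map_zero, Finset.sum_eq_single_of_mem x₀ hx₀] at key
  · rw [map_smul, W.kunnethComponent_externalCup_self hX₁ hX₂] at key
    refine (smul_eq_zero.mp key).resolve_right (tmul_ne_zero' ?_ ?_)
    · have h1 := x₀.1.1.isLt
      exact W.lefschetzPow_ne_zero_of_le hL hX₁ hη₁ (e := m₁ - x₀.1.1) (by omega) rfl hp0
    · have h2 := x₀.1.2.isLt
      exact W.lefschetzPow_ne_zero_of_le hL hX₂ hη₂ (e := m₂ - x₀.1.2) (by omega) rfl hq0
  · intro x _ hx
    rw [map_smul, W.kunnethComponent_externalCup_of_ne hX₁ hX₂ _ _ ?_, smul_zero]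
    intro heq
    apply hx
    simp only [Prod.mk.injEq] at heq
    exact Subtype.ext (Prod.ext (Fin.ext (by omega)) (Fin.ext (by omega)))

omit [CharZero K] in
/-- The index sets of the monomials of a block in two complementary degrees `i + j = 2D`
correspond under `(s, t) ↦ (m₁ - s, m₂ - t)`. [folklore] -/
theorem card_blockIndex_eq {m₁ m₂ i j : ℕ} (hij : i + j = 2 * (i₁ + m₁ + (i₂ + m₂))) :
    Fintype.card {st : Fin (m₁ + 1) × Fin (m₂ + 1) //
        i₁ + 2 * (st.1 : ℕ) + (i₂ + 2 * (st.2 : ℕ)) = j} =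
      Fintype.card {st : Fin (m₁ + 1) × Fin (m₂ + 1) //
        i₁ + 2 * (st.1 : ℕ) + (i₂ + 2 * (st.2 : ℕ)) = i} := by
  refine Fintype.card_congr (Equiv.subtypeEquiv (Equiv.prodCongr Fin.revPerm Fin.revPerm) ?_)
  intro st
  have h1 := st.1.isLt
  have h2 := st.2.isLt
  simp only [Equiv.prodCongr_apply, Prod.map, Fin.revPerm_apply, Fin.val_rev]
  omega

/-- **Hard Lefschetz inside a block**: for `p`, `q` primitive and `i + r = D`, every class of the
block in degree `i + 2r` is `Lʳ` of a class of the block in degree `i` — `Lʳ` is injective on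
`Hⁱ(X₁ × X₂)` (hard Lefschetz for the product polarisation, a hyperplane class by
`W.HasProdHyperplaneClasses`) and the two pieces of the block have the same dimension
(`linearIndependent_mono`, `card_blockIndex_eq`). [cite: Andre1996Motifs, §1.3] -/
theorem block_hardLefschetz (hL : W.HasHardLefschetz) (hPH : W.HasProdHyperplaneClasses)
    (hX₁ : IsSmoothProjective n₁ X₁) (hX₂ : IsSmoothProjective n₂ X₂)
    (hη₁ : W.IsHyperplaneClass X₁ η₁) (hη₂ : W.IsHyperplaneClass X₂ η₂)
    (hp : W.IsPrimitive n₁ η₁ p) (hq : W.IsPrimitive n₂ η₂ q) {i r j : ℕ} (hr : i + r = n₁ + n₂)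
    (h : i + 2 * r = j) {z : W.obj (X₁ ⊗ X₂) j} (hz : z ∈ Submodule.span K {z : W.obj (X₁ ⊗ X₂) j | ∃ (s t : ℕ) (h : i₁ + 2 * s + (i₂ + 2 * t) = j), z = W.externalCup X₁ X₂ h (W.lefschetzPow X₁ η₁ s i₁ (i₁ + 2 * s) rfl p) (W.lefschetzPow X₂ η₂ t i₂ (i₂ + 2 * t) rfl q)}) :
    ∃ w ∈ Submodule.span K {z : W.obj (X₁ ⊗ X₂) i | ∃ (s t : ℕ) (h : i₁ + 2 * s + (i₂ + 2 * t) = i), z = W.externalCup X₁ X₂ h (W.lefschetzPow X₁ η₁ s i₁ (i₁ + 2 * s) rfl p) (W.lefschetzPow X₂ η₂ t i₂ (i₂ + 2 * t) rfl q)},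
      W.lefschetzPow (X₁ ⊗ X₂) (W.prodPolarisation X₁ X₂ η₁ η₂) r i j h w = z := by
  have hP := IsSmoothProjective.tensor_holds hX₁ hX₂
  have hη : W.IsHyperplaneClass (X₁ ⊗ X₂) (W.prodPolarisation X₁ X₂ η₁ η₂) := hPH hX₁ hX₂ hη₁ hη₂
  -- degenerate blocks
  by_cases hp0 : p = 0
  · subst hp0
    have hz0 : z = 0 := by
      rw [← Submodule.mem_bot K, ← (Submodule.span_eq_bot.2 _ : _ = ⊥)]
      · exact hz
      · rintro _ ⟨s, t, h', rfl⟩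
        rw [map_zero, LinearMap.map_zero₂]
    exact ⟨0, zero_mem _, by rw [hz0, map_zero]⟩
  by_cases hq0 : q = 0
  · subst hq0
    have hz0 : z = 0 := by
      rw [← Submodule.mem_bot K, ← (Submodule.span_eq_bot.2 _ : _ = ⊥)]
      · exact hz
      · rintro _ ⟨s, t, h', rfl⟩
        rw [map_zero, map_zero]
    exact ⟨0, zero_mem _, by rw [hz0, map_zero]⟩
  -- live blocks: dimension count
  have hi₁ : i₁ ≤ n₁ := not_lt.mp fun hlt ↦ hp0 (hp.1 hlt)
  have hi₂ : i₂ ≤ n₂ := not_lt.mp fun hlt ↦ hq0 (hq.1 hlt)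
  obtain ⟨m₁, hm₁⟩ : ∃ m₁, i₁ + m₁ = n₁ := ⟨n₁ - i₁, by omega⟩
  obtain ⟨m₂, hm₂⟩ : ∃ m₂, i₂ + m₂ = n₂ := ⟨n₂ - i₂, by omega⟩
  haveI := W.finite_obj hP i
  haveI := W.finite_obj hP j
  set Bi := Submodule.span K {z : W.obj (X₁ ⊗ X₂) i | ∃ (s t : ℕ) (h : i₁ + 2 * s + (i₂ + 2 * t) = i), z = W.externalCup X₁ X₂ h (W.lefschetzPow X₁ η₁ s i₁ (i₁ + 2 * s) rfl p) (W.lefschetzPow X₂ η₂ t i₂ (i₂ + 2 * t) rfl q)} with hBi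
  set Bj := Submodule.span K {z : W.obj (X₁ ⊗ X₂) j | ∃ (s t : ℕ) (h : i₁ + 2 * s + (i₂ + 2 * t) = j), z = W.externalCup X₁ X₂ h (W.lefschetzPow X₁ η₁ s i₁ (i₁ + 2 * s) rfl p) (W.lefschetzPow X₂ η₂ t i₂ (i₂ + 2 * t) rfl q)} with hBj
  have hmaps : ∀ x ∈ Bi, W.lefschetzPow (X₁ ⊗ X₂) (W.prodPolarisation X₁ X₂ η₁ η₂) r i j h x ∈ Bj :=
    fun x hx ↦ W.lefschetzPow_mem_block hX₁ hX₂ r h hx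
  let f := (W.lefschetzPow (X₁ ⊗ X₂) (W.prodPolarisation X₁ X₂ η₁ η₂) r i j h).restrict hmaps
  have hinj : Function.Injective f := by
    intro x y hxy
    apply Subtype.ext
    apply (hL hP _ hη i r j hr h).1
    have := congrArg Subtype.val hxy
    simpa only [f, LinearMap.restrict_apply] using this
  have hfin : Module.finrank K Bi = Module.finrank K Bj := by
    refine le_antisymm (LinearMap.finrank_le_finrank_of_injective hinj) ?_
    calc Module.finrank K Bj
        = Module.finrank K (Submodule.span K (Set.range fun st : {st : Fin (m₁ + 1) × Fin (m₂ + 1) //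
              i₁ + 2 * (st.1 : ℕ) + (i₂ + 2 * (st.2 : ℕ)) = j} ↦
            W.externalCup X₁ X₂ st.2 (W.lefschetzPow X₁ η₁ (st.1.1 : ℕ) i₁ (i₁ + 2 * (st.1.1 : ℕ)) rfl p) (W.lefschetzPow X₂ η₂ (st.1.2 : ℕ) i₂ (i₂ + 2 * (st.1.2 : ℕ)) rfl q))) := by
          rw [hBj, W.block_eq_span_range hX₁ hX₂ hp hq hm₁ hm₂ j]
      _ ≤ Fintype.card {st : Fin (m₁ + 1) × Fin (m₂ + 1) //
              i₁ + 2 * (st.1 : ℕ) + (i₂ + 2 * (st.2 : ℕ)) = j} := finrank_range_le_card _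
      _ = Fintype.card {st : Fin (m₁ + 1) × Fin (m₂ + 1) //
              i₁ + 2 * (st.1 : ℕ) + (i₂ + 2 * (st.2 : ℕ)) = i} :=
          card_blockIndex_eq (by omega)
      _ = Module.finrank K (Submodule.span K (Set.range fun st : {st : Fin (m₁ + 1) × Fin (m₂ + 1) //
              i₁ + 2 * (st.1 : ℕ) + (i₂ + 2 * (st.2 : ℕ)) = i} ↦
            W.externalCup X₁ X₂ st.2 (W.lefschetzPow X₁ η₁ (st.1.1 : ℕ) i₁ (i₁ + 2 * (st.1.1 : ℕ)) rfl p) (W.lefschetzPow X₂ η₂ (st.1.2 : ℕ) i₂ (i₂ + 2 * (st.1.2 : ℕ)) rfl q))) :=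
          (finrank_span_eq_card (W.linearIndependent_mono hL hX₁ hX₂ hη₁ hη₂ hm₁ hm₂ hp0 hq0 i)).symm
      _ = Module.finrank K Bi := by
          rw [hBi, W.block_eq_span_range hX₁ hX₂ hp hq hm₁ hm₂ i]
  obtain ⟨⟨w, hw⟩, hfw⟩ :=
    (LinearMap.injective_iff_surjective_of_finrank_eq_finrank hfin).1 hinj ⟨z, hz⟩
  refine ⟨w, hw, ?_⟩
  have := congrArg Subtype.val hfw
  simpa only [f, LinearMap.restrict_apply] using this

/-- **A bi-primitive external product is primitive for the product polarisation**: for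
`p ∈ P^{i₁}(X₁)`, `q ∈ P^{i₂}(X₂)`, the class `p ⊠ q` is `η`-primitive on `X₁ × X₂`
(`L^{m₁+m₂+1} (p ⊠ q)` is a combination of monomials `L₁ˢ p ⊠ L₂ᵗ q`, `s + t = m₁ + m₂ + 1`, all
zero) — Lemme 1.3.1: `P^{i₁}(X₁) ⊗ P^{i₂}(X₂) ⊆ P^{i₁+i₂}(X₁ × X₂)`. [cite: Andre1996Motifs, §1.3 Lemme 1.3.1] -/
theorem isPrimitive_externalCup (hX₁ : IsSmoothProjective n₁ X₁) (hX₂ : IsSmoothProjective n₂ X₂)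
    (hp : W.IsPrimitive n₁ η₁ p) (hq : W.IsPrimitive n₂ η₂ q) :
    W.IsPrimitive (n₁ + n₂) (W.prodPolarisation X₁ X₂ η₁ η₂) (W.externalCup X₁ X₂ rfl p q) := by
  refine ⟨fun hlt ↦ ?_, fun r M h hr ↦ ?_⟩
  · by_cases h₁ : n₁ < i₁
    · rw [hp.1 h₁, LinearMap.map_zero₂]
    · rw [hq.1 (by omega), map_zero]
  · rw [← Submodule.mem_bot K, ← (Submodule.span_eq_bot.2 _ : _ = ⊥)]
    · exact W.lefschetzPow_externalCup_mem_span hX₁ hX₂ r h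
    · rintro _ ⟨s, t, hst, h', rfl⟩
      by_cases hs : n₁ + 1 ≤ i₁ + s
      · exact W.mono_eq_zero_left hX₁ hp h' hs
      · exact W.mono_eq_zero_right hX₂ hq h' (by omega)

/-- **Lemme 1.3.1 (top of a block)**: for `p ∈ P^{i₁}(X₁)`, `q ∈ P^{i₂}(X₂)` primitive
(`i₁ + m₁ = n₁`, `i₂ + m₂ = n₂`) and `⋆` a Lefschetz star operator of the product polarisation,
`⋆(L₁^{m₁} p ⊠ L₂^{m₂} q) = c · (p ⊠ q)` with `c ≠ 0`: indeed `L^{m₁+m₂} (p ⊠ q)` is a nonzero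
multiple of `L₁^{m₁} p ⊠ L₂^{m₂} q` (the only surviving monomial; nonzero multiple by hard
Lefschetz on `X₁ × X₂`) and `⋆ L^{m₁+m₂} = ±1` on `P^{i₁+i₂}(X₁ × X₂) ∋ p ⊠ q`. André:
«les isomorphismes `L^{n-i} Pⁱ(X) ⊗ L^{m-j} Pʲ(Y) → Pⁱ(X) ⊗ Pʲ(Y)` induits par l'involution de
Lefschetz relative à `X × Y` d'une part, et par `⋆ ⊗ ⋆` [à un facteur près] d'autre part,
coïncident». [cite: Andre1996Motifs, §1.3 Lemme 1.3.1] -/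
theorem star_topMono (hL : W.HasHardLefschetz) (hPH : W.HasProdHyperplaneClasses)
    (hX₁ : IsSmoothProjective n₁ X₁) (hX₂ : IsSmoothProjective n₂ X₂)
    (hη₁ : W.IsHyperplaneClass X₁ η₁) (hη₂ : W.IsHyperplaneClass X₂ η₂)
    (hp : W.IsPrimitive n₁ η₁ p) (hq : W.IsPrimitive n₂ η₂ q) {m₁ m₂ : ℕ} (hm₁ : i₁ + m₁ = n₁)
    (hm₂ : i₂ + m₂ = n₂) {S : W.GradedOp (X₁ ⊗ X₂) (X₁ ⊗ X₂)}
    (hS : W.IsLefschetzStar (n₁ + n₂) (W.prodPolarisation X₁ X₂ η₁ η₂) S) {N : ℕ}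
    (hN : i₁ + 2 * m₁ + (i₂ + 2 * m₂) = N) :
    ∃ c : K, c ≠ 0 ∧
      S N (i₁ + i₂) (W.externalCup X₁ X₂ hN (W.lefschetzPow X₁ η₁ m₁ i₁ (i₁ + 2 * m₁) rfl p) (W.lefschetzPow X₂ η₂ m₂ i₂ (i₂ + 2 * m₂) rfl q)) = c • W.externalCup X₁ X₂ rfl p q := by
  have hP := IsSmoothProjective.tensor_holds hX₁ hX₂
  have hη : W.IsHyperplaneClass (X₁ ⊗ X₂) (W.prodPolarisation X₁ X₂ η₁ η₂) := hPH hX₁ hX₂ hη₁ hη₂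
  -- `L^{m₁+m₂} (p ⊠ q)` is a multiple of the top monomial
  have hmem := W.lefschetzPow_externalCup_mem_span hX₁ hX₂ (η₁ := η₁) (η₂ := η₂) (a := p) (b := q)
    (m₁ + m₂) (M := N) (by omega)
  have hle : Submodule.span K {z | ∃ (s t : ℕ) (_ : s + t = m₁ + m₂)
      (h : i₁ + 2 * s + (i₂ + 2 * t) = N), z = W.externalCup X₁ X₂ h (W.lefschetzPow X₁ η₁ s i₁ (i₁ + 2 * s) rfl p) (W.lefschetzPow X₂ η₂ t i₂ (i₂ + 2 * t) rfl q)} ≤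
      K ∙ W.externalCup X₁ X₂ hN (W.lefschetzPow X₁ η₁ m₁ i₁ (i₁ + 2 * m₁) rfl p) (W.lefschetzPow X₂ η₂ m₂ i₂ (i₂ + 2 * m₂) rfl q) := by
    refine Submodule.span_le.2 ?_
    rintro _ ⟨s, t, hst, h', rfl⟩
    by_cases hs : s = m₁
    · obtain rfl := hs
      obtain rfl : t = m₂ := by omega
      exact Submodule.mem_span_singleton_self _
    by_cases hs' : n₁ + 1 ≤ i₁ + s
    · rw [W.mono_eq_zero_left hX₁ hp h' hs']
      exact zero_mem _
    · rw [W.mono_eq_zero_right hX₂ hq h' (by omega)]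
      exact zero_mem _
  obtain ⟨c', hc'⟩ := Submodule.mem_span_singleton.1 (hle hmem)
  -- `⋆ L^{m₁+m₂} (p ⊠ q) = ± (p ⊠ q)`
  have hstar : S N (i₁ + i₂) (W.lefschetzPow (X₁ ⊗ X₂) (W.prodPolarisation X₁ X₂ η₁ η₂)
      (m₁ + m₂) (i₁ + i₂) N (by omega) (W.externalCup X₁ X₂ rfl p q)) =
      ((starSign (i₁ + i₂) : ℤ) : K) • W.externalCup X₁ X₂ rfl p q := by
    rw [hS.2 (i₁ + i₂) _ (W.isPrimitive_externalCup hX₁ hX₂ hp hq) (m₁ + m₂) 0 N (i₁ + i₂)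
      (by omega) rfl (by omega), W.lefschetzPow_zero_apply hP, Int.cast_smul_eq_zsmul]
    rfl
  have hε : ((starSign (i₁ + i₂) : ℤ) : K) ≠ 0 := Int.cast_ne_zero.2 (Units.ne_zero _)
  by_cases hc0 : c' = 0
  · -- then `L^{m₁+m₂} (p ⊠ q) = 0`, so `p ⊠ q = 0` and the top monomial vanishes too
    rw [hc0, zero_smul] at hc'
    have hpq : W.externalCup X₁ X₂ rfl p q = 0 :=
      (hL hP _ hη (i₁ + i₂) (m₁ + m₂) N (by omega) (by omega)).1 (by rw [← hc', map_zero])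
    refine ⟨1, one_ne_zero, ?_⟩
    rw [W.mono_eq_cup hX₁ hX₂ m₁ m₂ N hN (by omega), hpq, LinearMap.map_zero₂, map_zero,
      smul_zero]
  · refine ⟨c'⁻¹ * ((starSign (i₁ + i₂) : ℤ) : K), mul_ne_zero (inv_ne_zero hc0) hε, ?_⟩
    have htop : W.externalCup X₁ X₂ hN (W.lefschetzPow X₁ η₁ m₁ i₁ (i₁ + 2 * m₁) rfl p) (W.lefschetzPow X₂ η₂ m₂ i₂ (i₂ + 2 * m₂) rfl q) =
        c'⁻¹ • W.lefschetzPow (X₁ ⊗ X₂) (W.prodPolarisation X₁ X₂ η₁ η₂) (m₁ + m₂) (i₁ + i₂) N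
          (by omega) (W.externalCup X₁ X₂ rfl p q) := by
      rw [← hc', smul_smul, inv_mul_cancel₀ hc0, one_smul]
    rw [htop, map_smul, hstar, smul_smul]

/-- **Blocks are stable under `⋆`**: for `p`, `q` primitive and `⋆` a Lefschetz star operator of the
product polarisation, `⋆` maps the block of `(p, q)` into itself (blocks are `L`-stable and the
hard-Lefschetz isomorphisms restrict to them, `block_hardLefschetz`; `star_mem_of_forall_mem`).
[cite: Andre1996Motifs, §1.3] -/
theorem star_mem_block (hL : W.HasHardLefschetz) (hPH : W.HasProdHyperplaneClasses)
    (hX₁ : IsSmoothProjective n₁ X₁) (hX₂ : IsSmoothProjective n₂ X₂)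
    (hη₁ : W.IsHyperplaneClass X₁ η₁) (hη₂ : W.IsHyperplaneClass X₂ η₂)
    (hp : W.IsPrimitive n₁ η₁ p) (hq : W.IsPrimitive n₂ η₂ q) {S : W.GradedOp (X₁ ⊗ X₂) (X₁ ⊗ X₂)}
    (hS : W.IsLefschetzStar (n₁ + n₂) (W.prodPolarisation X₁ X₂ η₁ η₂) S) {a b : ℕ}
    {y : W.obj (X₁ ⊗ X₂) a} (hy : y ∈ Submodule.span K {z : W.obj (X₁ ⊗ X₂) a | ∃ (s t : ℕ) (h : i₁ + 2 * s + (i₂ + 2 * t) = a), z = W.externalCup X₁ X₂ h (W.lefschetzPow X₁ η₁ s i₁ (i₁ + 2 * s) rfl p) (W.lefschetzPow X₂ η₂ t i₂ (i₂ + 2 * t) rfl q)}) :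
    S a b y ∈ Submodule.span K {z : W.obj (X₁ ⊗ X₂) b | ∃ (s t : ℕ) (h : i₁ + 2 * s + (i₂ + 2 * t) = b), z = W.externalCup X₁ X₂ h (W.lefschetzPow X₁ η₁ s i₁ (i₁ + 2 * s) rfl p) (W.lefschetzPow X₂ η₂ t i₂ (i₂ + 2 * t) rfl q)} :=
  W.star_mem_of_forall_mem (fun N ↦ Submodule.span K {z : W.obj (X₁ ⊗ X₂) N | ∃ (s t : ℕ) (h : i₁ + 2 * s + (i₂ + 2 * t) = N), z = W.externalCup X₁ X₂ h (W.lefschetzPow X₁ η₁ s i₁ (i₁ + 2 * s) rfl p) (W.lefschetzPow X₂ η₂ t i₂ (i₂ + 2 * t) rfl q)}) hL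
    (IsSmoothProjective.tensor_holds hX₁ hX₂) (hPH hX₁ hX₂ hη₁ hη₂)
    (fun h _ hx ↦ W.lefschetzPow_one_mem_block hX₁ hX₂ h hx)
    (fun hr h _ hz ↦ W.block_hardLefschetz hL hPH hX₁ hX₂ hη₁ hη₂ hp hq hr h hz) hS hy

end BlockStructure

/-! ## Lefschetz decompositions as finite sums -/

section Decomposition

variable {n : ℕ} {X : SchemeOver k} {η : W.obj X 2}

/-- **Lefschetz decomposition, finite-sum form** (Kleiman 1968 1.4.1; André 1996 §1.1
«`x = Σ Lᵏ x_{j-2k}` est la décomposition de Lefschetz de `x ∈ Hʲ(X)`»): under hard Lefschetz every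
`x ∈ Hʲ(X)` is a finite sum `Σ Lᵏ pᵢ` of iterated Lefschetz operators applied to primitive classes
`pᵢ ∈ Pⁱ(X)`, `i + 2k = j`, over *live* indices `i + k ≤ n` (from the spanning principle
`lefschetz_induction`; uniqueness is not needed here). [cite: Kleiman1968, §1.4 (1.4.1)] -/
theorem exists_sum_lefschetzPow_eq (hL : W.HasHardLefschetz) (hX : IsSmoothProjective n X)
    (hη : W.IsHyperplaneClass X η) {j : ℕ} (x : W.obj X j) :
    ∃ (s : Finset {ik : ℕ × ℕ // ik.1 + 2 * ik.2 = j})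
      (p : (ik : {ik : ℕ × ℕ // ik.1 + 2 * ik.2 = j}) → W.obj X ik.1.1),
      (∀ ik, W.IsPrimitive n η (p ik)) ∧ (∀ ik ∈ s, ik.1.1 + ik.1.2 ≤ n) ∧
        x = ∑ ik ∈ s, W.lefschetzPow X η ik.1.2 ik.1.1 j ik.2 (p ik) := by
  classical
  refine W.lefschetz_induction hL hX hη (C := fun x ↦ ∃ (s : Finset {ik : ℕ × ℕ // ik.1 + 2 * ik.2 = j})
      (p : (ik : {ik : ℕ × ℕ // ik.1 + 2 * ik.2 = j}) → W.obj X ik.1.1),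
      (∀ ik, W.IsPrimitive n η (p ik)) ∧ (∀ ik ∈ s, ik.1.1 + ik.1.2 ≤ n) ∧
        x = ∑ ik ∈ s, W.lefschetzPow X η ik.1.2 ik.1.1 j ik.2 (p ik)) ?_ ?_ ?_ x
  · exact ⟨∅, 0, fun ik ↦ (W.primitiveSubmodule X n η _).zero_mem, fun _ h ↦ absurd h (by simp),
      by simp⟩
  · rintro y z ⟨s, p, hp, hs, rfl⟩ ⟨s', p', hp', hs', rfl⟩
    refine ⟨s ∪ s', fun ik ↦ (if ik ∈ s then p ik else 0) + (if ik ∈ s' then p' ik else 0),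
      fun ik ↦ ?_, fun ik hik ↦ ?_, ?_⟩
    · refine (W.primitiveSubmodule X n η _).add_mem ?_ ?_
      · split_ifs
        · exact hp ik
        · exact (W.primitiveSubmodule X n η _).zero_mem
      · split_ifs
        · exact hp' ik
        · exact (W.primitiveSubmodule X n η _).zero_mem
    · rcases Finset.mem_union.1 hik with h | h
      · exact hs ik h
      · exact hs' ik h
    · simp only [map_add, Finset.sum_add_distrib]
      congr 1
      · rw [← Finset.sum_subset Finset.subset_union_left (fun ik _ hik ↦ by rw [if_neg hik, map_zero])]
        exact Finset.sum_congr rfl fun ik hik ↦ by rw [if_pos hik]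
      · rw [← Finset.sum_subset Finset.subset_union_right (fun ik _ hik ↦ by rw [if_neg hik, map_zero])]
        exact Finset.sum_congr rfl fun ik hik ↦ by rw [if_pos hik]
  · intro i j' h p₀ hp₀ hij
    refine ⟨{⟨(i, j'), h⟩}, Function.update 0 ⟨(i, j'), h⟩ p₀, fun ik ↦ ?_, fun ik hik ↦ ?_, ?_⟩
    · by_cases hik : ik = ⟨(i, j'), h⟩
      · subst hik
        rw [Function.update_self]
        exact hp₀
      · rw [Function.update_of_ne hik]
        exact (W.primitiveSubmodule X n η _).zero_mem
    · rw [Finset.mem_singleton] at hik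
      subst hik
      exact hij
    · rw [Finset.sum_singleton, Function.update_self]

end Decomposition

/-! ## Elimination and Lemme 1.3.2 -/

section Elimination

variable {n₁ n₂ : ℕ} {X₁ X₂ : SchemeOver k} {η₁ : W.obj X₁ 2} {η₂ : W.obj X₂ 2}

/-- Normalisation of the target degrees of the two Lefschetz operators in an external product
`L₁ˢ a ⊠ L₂ᵗ b` (they differ only in the proofs of the degree identities). [folklore] -/
theorem externalCup_lefschetzPow_eq {i₁ i₂ : ℕ} (a : W.obj X₁ i₁) (b : W.obj X₂ i₂)
    {s t J₁ J₂ N : ℕ} (e₁ : i₁ + 2 * s = J₁) (e₂ : i₂ + 2 * t = J₂) (h' : J₁ + J₂ = N)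
    (h : i₁ + 2 * s + (i₂ + 2 * t) = N) :
    W.externalCup X₁ X₂ h' (W.lefschetzPow X₁ η₁ s i₁ J₁ e₁ a) (W.lefschetzPow X₂ η₂ t i₂ J₂ e₂ b) =
      W.externalCup X₁ X₂ h (W.lefschetzPow X₁ η₁ s i₁ (i₁ + 2 * s) rfl a) (W.lefschetzPow X₂ η₂ t i₂ (i₂ + 2 * t) rfl b) := by
  subst e₁ e₂
  rfl

/-- **Elimination** (the heart of the proof of Lemme 1.3.2): let `x = Σₖ L₁ᵏ pₖ ∈ H^{j₁}(X₁)`,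
`y = Σₗ L₂ˡ qₗ ∈ H^{j₂}(X₂)` be Lefschetz decompositions (finite sums over live indices, primitive
`pₖ`, `qₗ`) and `⋆` a Lefschetz star operator of the product polarisation. Then EVERY monomial
`L₁ᵃ pₖ ⊠ L₂ᵇ qₗ` of every block lies in the span of the classes
`⋆((x ⊠ y) ∪ (η₁ᶜ ⊠ η₂ᵍ)) ∪ (η₁ᵃ' ⊠ η₂ᵇ')`. Descending induction over the pairs `(k, l)`: with
`c = n₁ - iₖ - k`, `g = n₂ - i'ₗ - l`, the class `(x ⊠ y) ∪ (η₁ᶜ ⊠ η₂ᵍ)` is the top monomial of the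
block of `(pₖ, qₗ)` plus monomials of the blocks of the pairs `(k', l') > (k, l)` (the pairs with
`k' < k` or `l' < l` die), `⋆` of the top is `c₀ · (pₖ ⊠ qₗ)`, `c₀ ≠ 0` (`star_topMono`), `⋆` and the
cup product with `η₁ᵃ ⊠ η₂ᵇ` preserve the other blocks (`star_mem_block`), which lie in the span by
induction. [cite: Andre1996Motifs, §1.3 proof of Lemme 1.3.2] -/
theorem mono_mem_starSpan (hL : W.HasHardLefschetz) (hPH : W.HasProdHyperplaneClasses)
    (hX₁ : IsSmoothProjective n₁ X₁) (hX₂ : IsSmoothProjective n₂ X₂)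
    (hη₁ : W.IsHyperplaneClass X₁ η₁) (hη₂ : W.IsHyperplaneClass X₂ η₂)
    {S : W.GradedOp (X₁ ⊗ X₂) (X₁ ⊗ X₂)}
    (hS : W.IsLefschetzStar (n₁ + n₂) (W.prodPolarisation X₁ X₂ η₁ η₂) S)
    {j₁ j₂ : ℕ} {x : W.obj X₁ j₁} {y : W.obj X₂ j₂}
    (sx : Finset {ik : ℕ × ℕ // ik.1 + 2 * ik.2 = j₁})
    (px : (ik : {ik : ℕ × ℕ // ik.1 + 2 * ik.2 = j₁}) → W.obj X₁ ik.1.1)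
    (hpx : ∀ ik, W.IsPrimitive n₁ η₁ (px ik)) (hsx : ∀ ik ∈ sx, ik.1.1 + ik.1.2 ≤ n₁)
    (hx : x = ∑ ik ∈ sx, W.lefschetzPow X₁ η₁ ik.1.2 ik.1.1 j₁ ik.2 (px ik))
    (sy : Finset {il : ℕ × ℕ // il.1 + 2 * il.2 = j₂})
    (qy : (il : {il : ℕ × ℕ // il.1 + 2 * il.2 = j₂}) → W.obj X₂ il.1.1)
    (hqy : ∀ il, W.IsPrimitive n₂ η₂ (qy il)) (hsy : ∀ il ∈ sy, il.1.1 + il.1.2 ≤ n₂)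
    (hy : y = ∑ il ∈ sy, W.lefschetzPow X₂ η₂ il.1.2 il.1.1 j₂ il.2 (qy il))
    {ik : {ik : ℕ × ℕ // ik.1 + 2 * ik.2 = j₁}} (hik : ik ∈ sx)
    {il : {il : ℕ × ℕ // il.1 + 2 * il.2 = j₂}} (hil : il ∈ sy) (a' b' : ℕ) {T : ℕ}
    (hT : ik.1.1 + 2 * a' + (il.1.1 + 2 * b') = T) :
    W.externalCup X₁ X₂ hT (W.lefschetzPow X₁ η₁ a' ik.1.1 (ik.1.1 + 2 * a') rfl (px ik)) (W.lefschetzPow X₂ η₂ b' il.1.1 (il.1.1 + 2 * b') rfl (qy il)) ∈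
      Submodule.span K {z : W.obj (X₁ ⊗ X₂) T | ∃ (a b c g M M' : ℕ)
        (hM : j₁ + j₂ + (2 * c + 2 * g) = M) (hT' : M' + (2 * a + 2 * b) = T),
        z = W.cup hT' (S M M' (W.cup hM (W.externalCup X₁ X₂ rfl x y)
              (W.externalCup X₁ X₂ rfl (W.pow X₁ η₁ c) (W.pow X₂ η₂ g))))
            (W.externalCup X₁ X₂ rfl (W.pow X₁ η₁ a) (W.pow X₂ η₂ b))} := by
  classical
  have hP := IsSmoothProjective.tensor_holds hX₁ hX₂
  -- the double-sum expansion of `x ⊠ y`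
  have hxy : W.externalCup X₁ X₂ rfl x y = ∑ ik ∈ sx, ∑ il ∈ sy,
      W.externalCup X₁ X₂ (by have := ik.2; have := il.2; omega) (W.lefschetzPow X₁ η₁ ik.1.2 ik.1.1 (ik.1.1 + 2 * ik.1.2) rfl (px ik)) (W.lefschetzPow X₂ η₂ il.1.2 il.1.1 (il.1.1 + 2 * il.1.2) rfl (qy il)) := by
    rw [hx, hy, LinearMap.map_sum₂]
    refine Finset.sum_congr rfl fun ik _ ↦ ?_
    rw [map_sum]
    exact Finset.sum_congr rfl fun il _ ↦ W.externalCup_lefschetzPow_eq _ _ _ _ _ _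
  -- descending induction over the pairs, measured by `e = j₁ + j₂ - (k + l)`
  suffices key : ∀ (e : ℕ) (ik : {ik : ℕ × ℕ // ik.1 + 2 * ik.2 = j₁}), ik ∈ sx →
      ∀ (il : {il : ℕ × ℕ // il.1 + 2 * il.2 = j₂}), il ∈ sy → ik.1.2 + il.1.2 + e = j₁ + j₂ →
      ∀ (a' b' : ℕ) (T : ℕ) (hT : ik.1.1 + 2 * a' + (il.1.1 + 2 * b') = T),
      W.externalCup X₁ X₂ hT (W.lefschetzPow X₁ η₁ a' ik.1.1 (ik.1.1 + 2 * a') rfl (px ik)) (W.lefschetzPow X₂ η₂ b' il.1.1 (il.1.1 + 2 * b') rfl (qy il)) ∈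
        Submodule.span K {z : W.obj (X₁ ⊗ X₂) T | ∃ (a b c g M M' : ℕ)
          (hM : j₁ + j₂ + (2 * c + 2 * g) = M) (hT' : M' + (2 * a + 2 * b) = T),
          z = W.cup hT' (S M M' (W.cup hM (W.externalCup X₁ X₂ rfl x y)
                (W.externalCup X₁ X₂ rfl (W.pow X₁ η₁ c) (W.pow X₂ η₂ g))))
              (W.externalCup X₁ X₂ rfl (W.pow X₁ η₁ a) (W.pow X₂ η₂ b))} by
    have h1 := ik.2
    have h2 := il.2
    exact key (j₁ + j₂ - (ik.1.2 + il.1.2)) ik hik il hil (by omega) a' b' T hT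
  intro e
  refine Nat.strong_induction_on e fun e IH ↦ ?_
  intro ik hik il hil he a' b' T hT
  -- exponents sending the components `ik`, `il` to the tops of their strings
  obtain ⟨c, hc⟩ : ∃ c, ik.1.1 + ik.1.2 + c = n₁ := ⟨n₁ - (ik.1.1 + ik.1.2), by have := hsx ik hik; omega⟩
  obtain ⟨g, hg⟩ : ∃ g, il.1.1 + il.1.2 + g = n₂ := ⟨n₂ - (il.1.1 + il.1.2), by have := hsy il hil; omega⟩
  have eik := ik.2
  have eil := il.2
  set M := j₁ + j₂ + (2 * c + 2 * g) with hMdef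
  -- the expansion of `(x ⊠ y) ∪ (η₁ᶜ ⊠ η₂ᵍ)` in monomials
  have hcup : W.cup (rfl : j₁ + j₂ + (2 * c + 2 * g) = M) (W.externalCup X₁ X₂ rfl x y)
      (W.externalCup X₁ X₂ rfl (W.pow X₁ η₁ c) (W.pow X₂ η₂ g)) = ∑ kl ∈ sx ×ˢ sy,
      W.externalCup X₁ X₂ (by have := kl.1.2; have := kl.2.2; omega) (W.lefschetzPow X₁ η₁ (kl.1.1.2 + c) kl.1.1.1 (kl.1.1.1 + 2 * (kl.1.1.2 + c)) rfl (px kl.1)) (W.lefschetzPow X₂ η₂ (kl.2.1.2 + g) kl.2.1.1 (kl.2.1.1 + 2 * (kl.2.1.2 + g)) rfl (qy kl.2)) := by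
    rw [hxy, LinearMap.map_sum₂, Finset.sum_product]
    refine Finset.sum_congr rfl fun ik' _ ↦ ?_
    rw [LinearMap.map_sum₂]
    refine Finset.sum_congr rfl fun il' _ ↦ ?_
    exact W.mono_cup_extPow hX₁ hX₂ _ _ _ _ c g M rfl _
  -- isolate the pair `(ik, il)`: its term is the top monomial of the block of `(pₖ, qₗ)`
  have hmem : (ik, il) ∈ sx ×ˢ sy := Finset.mem_product.2 ⟨hik, hil⟩
  rw [← Finset.add_sum_erase _ _ hmem] at hcup
  dsimp only at hcup
  -- `⋆` of the top monomial
  obtain ⟨c₀, hc₀, hstar⟩ := W.star_topMono hL hPH hX₁ hX₂ hη₁ hη₂ (hpx ik) (hqy il)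
    (m₁ := ik.1.2 + c) (m₂ := il.1.2 + g) (by omega) (by omega) hS (N := M) (by omega)
  -- the generator attached to `(a', b', c, g)`
  have hT' : ik.1.1 + il.1.1 + (2 * a' + 2 * b') = T := by omega
  have hgen : W.cup hT' (S M (ik.1.1 + il.1.1) (W.cup (rfl : j₁ + j₂ + (2 * c + 2 * g) = M)
      (W.externalCup X₁ X₂ rfl x y) (W.externalCup X₁ X₂ rfl (W.pow X₁ η₁ c) (W.pow X₂ η₂ g))))
      (W.externalCup X₁ X₂ rfl (W.pow X₁ η₁ a') (W.pow X₂ η₂ b')) ∈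
      Submodule.span K {z : W.obj (X₁ ⊗ X₂) T | ∃ (a b c g M M' : ℕ)
          (hM : j₁ + j₂ + (2 * c + 2 * g) = M) (hT' : M' + (2 * a + 2 * b) = T),
          z = W.cup hT' (S M M' (W.cup hM (W.externalCup X₁ X₂ rfl x y)
                (W.externalCup X₁ X₂ rfl (W.pow X₁ η₁ c) (W.pow X₂ η₂ g))))
              (W.externalCup X₁ X₂ rfl (W.pow X₁ η₁ a) (W.pow X₂ η₂ b))} :=
    Submodule.subset_span ⟨a', b', c, g, M, _, rfl, hT', rfl⟩
  rw [hcup, map_add, LinearMap.map_add₂, hstar, LinearMap.map_smul₂,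
    ← W.mono_eq_cup hX₁ hX₂ a' b' T hT hT', map_sum, LinearMap.map_sum₂] at hgen
  -- the remaining terms lie in the span, by induction
  have hrest : ∑ kl ∈ (sx ×ˢ sy).erase (ik, il), W.cup hT' (S M (ik.1.1 + il.1.1)
      (W.externalCup X₁ X₂ (by have := kl.1.2; have := kl.2.2; omega) (W.lefschetzPow X₁ η₁ (kl.1.1.2 + c) kl.1.1.1 (kl.1.1.1 + 2 * (kl.1.1.2 + c)) rfl (px kl.1)) (W.lefschetzPow X₂ η₂ (kl.2.1.2 + g) kl.2.1.1 (kl.2.1.1 + 2 * (kl.2.1.2 + g)) rfl (qy kl.2))))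
      (W.externalCup X₁ X₂ rfl (W.pow X₁ η₁ a') (W.pow X₂ η₂ b')) ∈
      Submodule.span K {z : W.obj (X₁ ⊗ X₂) T | ∃ (a b c g M M' : ℕ)
          (hM : j₁ + j₂ + (2 * c + 2 * g) = M) (hT' : M' + (2 * a + 2 * b) = T),
          z = W.cup hT' (S M M' (W.cup hM (W.externalCup X₁ X₂ rfl x y)
                (W.externalCup X₁ X₂ rfl (W.pow X₁ η₁ c) (W.pow X₂ η₂ g))))
              (W.externalCup X₁ X₂ rfl (W.pow X₁ η₁ a) (W.pow X₂ η₂ b))} := by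
    refine Submodule.sum_mem _ fun kl hkl ↦ ?_
    obtain ⟨hne, hkl'⟩ := Finset.mem_erase.1 hkl
    obtain ⟨hk1, hk2⟩ := Finset.mem_product.1 hkl'
    have e1 := kl.1.2
    have e2 := kl.2.2
    -- the pairs with `k' < k` or `l' < l` die
    by_cases hlt₁ : kl.1.1.2 < ik.1.2
    · rw [W.mono_eq_zero_left hX₁ (hpx kl.1) _ (by omega), map_zero, LinearMap.map_zero₂]
      exact zero_mem _
    by_cases hlt₂ : kl.2.1.2 < il.1.2
    · rw [W.mono_eq_zero_right hX₂ (hqy kl.2) _ (by omega), map_zero, LinearMap.map_zero₂]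
      exact zero_mem _
    -- the others are higher pairs: their whole block lies in the span by induction
    have hgt : ik.1.2 + il.1.2 < kl.1.1.2 + kl.2.1.2 := by
      by_contra hle
      apply hne
      have hk : kl.1.1.2 = ik.1.2 := by omega
      have hl : kl.2.1.2 = il.1.2 := by omega
      have hk' : kl.1.1.1 = ik.1.1 := by omega
      have hl' : kl.2.1.1 = il.1.1 := by omega
      exact Prod.ext (Subtype.ext (Prod.ext hk' hk)) (Subtype.ext (Prod.ext hl' hl))
    have hblock : Submodule.span K {z : W.obj (X₁ ⊗ X₂) T | ∃ (s t : ℕ) (h : kl.1.1.1 + 2 * s + (kl.2.1.1 + 2 * t) = T), z = W.externalCup X₁ X₂ h (W.lefschetzPow X₁ η₁ s kl.1.1.1 (kl.1.1.1 + 2 * s) rfl (px kl.1)) (W.lefschetzPow X₂ η₂ t kl.2.1.1 (kl.2.1.1 + 2 * t) rfl (qy kl.2))} ≤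
        Submodule.span K {z : W.obj (X₁ ⊗ X₂) T | ∃ (a b c g M M' : ℕ)
          (hM : j₁ + j₂ + (2 * c + 2 * g) = M) (hT' : M' + (2 * a + 2 * b) = T),
          z = W.cup hT' (S M M' (W.cup hM (W.externalCup X₁ X₂ rfl x y)
                (W.externalCup X₁ X₂ rfl (W.pow X₁ η₁ c) (W.pow X₂ η₂ g))))
              (W.externalCup X₁ X₂ rfl (W.pow X₁ η₁ a) (W.pow X₂ η₂ b))} := by
      refine Submodule.span_le.2 ?_
      rintro _ ⟨s', t', h', rfl⟩
      exact IH (j₁ + j₂ - (kl.1.1.2 + kl.2.1.2)) (by omega) kl.1 hk1 kl.2 hk2 (by omega) s' t' T h'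
    refine hblock (W.cup_extPow_mem_block hX₁ hX₂ ?_ a' b' T hT')
    exact W.star_mem_block hL hPH hX₁ hX₂ hη₁ hη₂ (hpx kl.1) (hqy kl.2) hS
      (W.mono_mem_block _ _ _ _)
  -- conclusion: `mono = c₀⁻¹ • (generator - rest)`
  have hfinal := Submodule.smul_mem _ c₀⁻¹ (Submodule.sub_mem _ hgen hrest)
  rwa [add_sub_cancel_right, smul_smul, inv_mul_cancel₀ hc₀, one_smul] at hfinal

/-- **André's Lemme 1.3.2** (qualitative form). Let `W` have hard Lefschetz and product hyperplane
classes, let `(X₁, η₁)`, `(X₂, η₂)` be smooth projective varieties polarised by hyperplane classes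
with Lefschetz star operators `⋆₁`, `⋆₂` (Kleiman's `⋆`, `W.IsLefschetzStar`), and let `⋆` be a
Lefschetz star operator of `X₁ × X₂` for the product polarisation `η = pr₁* η₁ + pr₂* η₂`. Then for
all `x ∈ H^{j₁}(X₁)`, `y ∈ H^{j₂}(X₂)` the external product `⋆₁ x ⊠ ⋆₂ y` lies in the `K`-span of
the classes `⋆((x ⊠ y) ∪ (η₁ᶜ ⊠ η₂ᵍ)) ∪ (η₁ᵃ ⊠ η₂ᵇ)`, `a, b, c, g ∈ ℕ` — André: «Il existe des
nombres rationnels `r` tels que pour tous `x ∈ Hᵖ(X)`, `y ∈ H^q(Y)`, on ait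
`⋆ x ⊗ ⋆ y = Σ r {(L_X^• ⊗ L_Y^•) ∘ ⋆_{X×Y} ∘ (L_X^• x ⊗ L_Y^• y) …}`» (one `⋆_{X×Y}` per term;
here the external monomials `L_X^• ⊗ L_Y^•` are the cup products with `η₁^• ⊠ η₂^•`, and the
terms `⋆ L_{X×Y} (…)` of the printed formula are among ours since `L_{X×Y}` is the cup product
with `η₁ ⊠ 1 + 1 ⊠ η₂`). Proof: Lefschetz-decompose `x` and `y`
(`exists_sum_lefschetzPow_eq`), so that `⋆₁ x ⊠ ⋆₂ y = Σ ± L₁^• pₖ ⊠ L₂^• qₗ` is a combination of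
monomials of the blocks `B(pₖ, qₗ)`, and apply the elimination `mono_mem_starSpan`.
[cite: Andre1996Motifs, §1.3 Lemme 1.3.2] -/
theorem star_externalCup_star_mem_span (hL : W.HasHardLefschetz)
    (hPH : W.HasProdHyperplaneClasses) (hX₁ : IsSmoothProjective n₁ X₁)
    (hX₂ : IsSmoothProjective n₂ X₂) (hη₁ : W.IsHyperplaneClass X₁ η₁)
    (hη₂ : W.IsHyperplaneClass X₂ η₂) {S₁ : W.GradedOp X₁ X₁} (hS₁ : W.IsLefschetzStar n₁ η₁ S₁)
    {S₂ : W.GradedOp X₂ X₂} (hS₂ : W.IsLefschetzStar n₂ η₂ S₂)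
    {S : W.GradedOp (X₁ ⊗ X₂) (X₁ ⊗ X₂)}
    (hS : W.IsLefschetzStar (n₁ + n₂) (W.prodPolarisation X₁ X₂ η₁ η₂) S)
    {j₁ j₂ j₁' j₂' T : ℕ} (hT : j₁' + j₂' = T) (x : W.obj X₁ j₁) (y : W.obj X₂ j₂) :
    W.externalCup X₁ X₂ hT (S₁ j₁ j₁' x) (S₂ j₂ j₂' y) ∈
      Submodule.span K {z : W.obj (X₁ ⊗ X₂) T | ∃ (a b c g M M' : ℕ)
        (hM : j₁ + j₂ + (2 * c + 2 * g) = M) (hT' : M' + (2 * a + 2 * b) = T),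
        z = W.cup hT' (S M M' (W.cup hM (W.externalCup X₁ X₂ rfl x y)
              (W.externalCup X₁ X₂ rfl (W.pow X₁ η₁ c) (W.pow X₂ η₂ g))))
            (W.externalCup X₁ X₂ rfl (W.pow X₁ η₁ a) (W.pow X₂ η₂ b))} := by
  classical
  -- off total degree `2n` the star operators vanish
  by_cases hj₁ : j₁ + j₁' = 2 * n₁
  swap
  · rw [hS₁.1 j₁ j₁' hj₁, LinearMap.zero_apply, LinearMap.map_zero₂]
    exact zero_mem _
  by_cases hj₂ : j₂ + j₂' = 2 * n₂
  swap
  · rw [hS₂.1 j₂ j₂' hj₂, LinearMap.zero_apply, map_zero]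
    exact zero_mem _
  -- Lefschetz decompositions of `x` and `y`
  obtain ⟨sx, px, hpx, hsx, hx⟩ := W.exists_sum_lefschetzPow_eq hL hX₁ hη₁ x
  obtain ⟨sy, qy, hqy, hsy, hy⟩ := W.exists_sum_lefschetzPow_eq hL hX₂ hη₂ y
  -- `⋆₁ x ⊠ ⋆₂ y` as a double sum over the two decompositions
  have hsum : W.externalCup X₁ X₂ hT (S₁ j₁ j₁' x) (S₂ j₂ j₂' y) = ∑ ik ∈ sx, ∑ il ∈ sy,
      W.externalCup X₁ X₂ hT (S₁ j₁ j₁' (W.lefschetzPow X₁ η₁ ik.1.2 ik.1.1 j₁ ik.2 (px ik)))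
        (S₂ j₂ j₂' (W.lefschetzPow X₂ η₂ il.1.2 il.1.1 j₂ il.2 (qy il))) := by
    rw [hx, hy, map_sum (S₁ j₁ j₁'), map_sum (S₂ j₂ j₂'), LinearMap.map_sum₂]
    refine Finset.sum_congr rfl fun ik _ ↦ ?_
    rw [map_sum]
  rw [hsum]
  refine Submodule.sum_mem _ fun ik hik ↦ Submodule.sum_mem _ fun il hil ↦ ?_
  have e1 := ik.2
  have e2 := il.2
  obtain ⟨s₁, hs₁⟩ : ∃ s₁, ik.1.1 + ik.1.2 + s₁ = n₁ :=
    ⟨n₁ - (ik.1.1 + ik.1.2), by have := hsx ik hik; omega⟩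
  obtain ⟨s₂, hs₂⟩ : ∃ s₂, il.1.1 + il.1.2 + s₂ = n₂ :=
    ⟨n₂ - (il.1.1 + il.1.2), by have := hsy il hil; omega⟩
  rw [hS₁.2 ik.1.1 (px ik) (hpx ik) ik.1.2 s₁ j₁ j₁' ik.2 (by omega) hs₁,
    hS₂.2 il.1.1 (qy il) (hqy il) il.1.2 s₂ j₂ j₂' il.2 (by omega) hs₂,
    ← Int.cast_smul_eq_zsmul K, ← Int.cast_smul_eq_zsmul K, LinearMap.map_smul₂, map_smul]
  refine Submodule.smul_mem _ _ (Submodule.smul_mem _ _ ?_)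
  rw [W.externalCup_lefschetzPow_eq (η₁ := η₁) (η₂ := η₂) (px ik) (qy il) _ _ hT (by omega)]
  exact W.mono_mem_starSpan hL hPH hX₁ hX₂ hη₁ hη₂ hS sx px hpx hsx hx sy qy hqy hsy hy hik hil
    s₁ s₂ _

end Elimination

end WeilCohomology

end Literature.AlgebraicGeometry.Motives

end
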